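import Summits.QuantumFields.BalabanUV.Beta.GAN24.FibreRateFeedTerms
import Summits.QuantumFields.BalabanUV.Beta.GAN24.SourceSideBound
import Summits.QuantumFields.BalabanUV.Beta.GAN24.SourceSideRate
import Summits.QuantumFields.BalabanUV.Beta.GAN24.SourceSideRatePhiSum

/-!
# `BalabanUV.Beta.GAN24.FibreRateData` — binder row G-an2-4 / (CONV-C), road P1-fibre, leaf **P1-L11** `FibreRate` (Part B), assembly part 1/2:
# PART S's source-side bounds/rates (leaf-07-g6) in this seat's hypothesis shapes, and the READING side by `R = −conj S`

NOT IN PRINT; OUR PROOF ATTEMPT.  HONEST FRAMING (cell contract, verbatim): «discharging `BetaPertH` makes Bałaban's UV stability UNCONDITIONAL — a real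
constructive-QFT result; it is NOT the continuum limit and NOT the Clay problem.»  HONEST DEPENDENCY (verbatim): «continuum YM on T⁴ ⇐ BetaPertH ∧ nine spine
estimates (0/9 proved); BetaPertH ⇐ (D1) ∧ (D4) ∧ CAP+tail; G-an2-4 gates asym, D1 and NE2/3/4.»  [folklore] rewriting BY NAME of leaf-07's PART S
(`SourceSideBound.norm_srcPhi_fhatF_le`/`norm_srcC_fhatF_le`, `SourceSideRate.srcC_rate`, `SourceSideRatePhiSum.srcPhi_rate`, `readingPhi_eq`/`readingC_eq`)
and leaf-11's summands (`FibreRateFeedTerms.rPhiTerm/rCTerm`); no cited fact, no wall binder, no `def … : Prop` hypothesis; 4 `def`s = PART S's displayed data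
(`bPhi`, `bC`, `rPhi`, `rC`).  NOT summit progress: inputs of shape (I2′) only; nothing of (CONV-C)'s K-slot is discharged; 0 wall binders; NOT `BetaPertH`,
NOT continuum, NOT Clay.

## What is proved (`d = 3`; two-step pairs `N = M·Lc ≤ N′ = M′·Lc`; real `q ∈ [−π, π]^4 ∖ {0}`)
`srcPhi_bound`/`srcC_bound` (`‖N⁻³·S‖ ≤ bPhi/bC`), `srcPhi_rate'`/`srcC_rate'` (`≤ rPhi/N²`, `≤ rC/N²`), `sum_rPhiTerm_eq`/`sum_rCTerm_eq` (`Σ_m R = −conj S` over all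
classes), `rPhi_bound`/`rC_bound`, `rPhi_rate`/`rC_rate` (the reading side inherits the source side's data at the same leg).

Unit `b2b-balaban-gan24-formalise-leaf-20` (G-an2-4 formalisation swarm, leaf prover 20), 2026-08-20.  Value = kernel assembly leaf toward the K-slot route P1,
NOT summit progress.
-/

noncomputable section

open Complex Finset
open scoped BigOperators Real ComplexConjugate

namespace Summit.QuantumFields.BalabanUV.Beta.GAN24.FibreRateData

open Literature.Probability.LatticeModels (TorusSite)
open Literature.MathematicalPhysics.QuantumFieldTheory.Balaban1983to89.B4Strip (ofRealVec)
open Literature.MathematicalPhysics.QuantumFieldTheory.King1986 (momSq momSq_nonneg)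
open AliasObjects (cap phiSol cSol srcPhi srcC readW Ahat fhatF eVec reg reg_eq_univ conj_ofRealVec)
open FibreRateFeedTerms (rPhiTerm rCTerm)
open CapacitanceScalarBounds (momSq_pos)
open CapacitanceScalarDictionary (LAl_ofRealVec_ne_zero)
open SourceSideBound (norm_srcPhi_fhatF_le norm_srcC_fhatF_le)
open SourceSideRate (rcPole rcBox rcPole_nonneg rcBox_nonneg srcC_rate)
open SourceSideRatePhiSum (rPhiPole rPhiBox rPhiPole_nonneg rPhiBox_nonneg srcPhi_rate readingPhi_eq readingC_eq)

variable {Lc : ℕ} [NeZero Lc]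

/-! ## §1 PART S's data in this seat's hypothesis shapes -/

/-- PART S's bound of `N⁻³·S_φ`: `bPhi Lc q = (π²/8 + π⁴/32)/|q|² + (1 + Lc)/8·(1 + 4Lc)^4` (leaf-07's `norm_srcPhi_fhatF_le`). -/
def bPhi (Lc : ℕ) (q : Fin (3 + 1) → ℝ) : ℝ := (π ^ 2 / 8 + π ^ 4 / 32) / momSq q + (1 + (Lc : ℝ)) / 8 * (1 + 4 * (Lc : ℝ)) ^ (3 + 1)

/-- PART S's bound of `N⁻³·S_c`: `bC Lc q = π⁴/16/(|q|²√|q|²) + Lc/8·(1 + 4Lc)^4` (leaf-07's `norm_srcC_fhatF_le`). -/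
def bC (Lc : ℕ) (q : Fin (3 + 1) → ℝ) : ℝ := π ^ 4 / 16 / (momSq q * Real.sqrt (momSq q)) + (Lc : ℝ) / 8 * (1 + 4 * (Lc : ℝ)) ^ (3 + 1)

/-- PART S's (p-uniform) rate of `N⁻³·S_φ`: `rPhi Lc = rPhiPole + rPhiBox 4 Lc` (leaf-07's `srcPhi_rate`). -/
def rPhi (Lc : ℕ) : ℝ := rPhiPole + rPhiBox (3 + 1) Lc

/-- PART S's rate of `N⁻³·S_c`: `rC Lc q = rcPole/√|q|² + rcBox 4 Lc` (leaf-07's `srcC_rate`). -/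
def rC (Lc : ℕ) (q : Fin (3 + 1) → ℝ) : ℝ := rcPole / Real.sqrt (momSq q) + rcBox (3 + 1) Lc

/-- [folklore] `0 ≤ rPhi Lc`. -/
theorem rPhi_nonneg (Lc : ℕ) : 0 ≤ rPhi Lc := add_nonneg rPhiPole_nonneg (rPhiBox_nonneg _ _)

section Data
variable {N M N' M' : ℕ} [NeZero N] [NeZero M] [NeZero N'] [NeZero M'] {q : Fin (3 + 1) → ℝ}

/-- [folklore] `‖N⁻³·srcPhi(f̂_{l,y′})(l′)‖ ≤ bPhi Lc q`. -/
theorem srcPhi_bound (hNM : N = M * Lc) (hq : ∀ i, |q i| ≤ π) (hq0 : q ≠ 0) (l : Fin (3 + 1)) (y' : Fin (3 + 1) → ℤ) (l' : Fin (3 + 1)) :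
    ‖(((N : ℂ) ^ 3)⁻¹) * srcPhi N (ofRealVec q) (fhatF N M (ofRealVec q) l y') 0 l'‖ ≤ bPhi Lc q := by
  have hN0 : (0 : ℝ) < N := by exact_mod_cast Nat.pos_of_ne_zero (NeZero.ne N)
  have h := norm_srcPhi_fhatF_le hNM hq hq0 l' l y'
  rw [norm_mul, norm_inv, norm_pow, Complex.norm_natCast]
  calc ((N : ℝ) ^ 3)⁻¹ * ‖srcPhi N (ofRealVec q) (fhatF N M (ofRealVec q) l y') 0 l'‖
      ≤ ((N : ℝ) ^ 3)⁻¹ * ((N : ℝ) ^ 3 * ((π ^ 2 / 8 + π ^ 4 / 32) / momSq q + (1 + (Lc : ℝ)) / 8 * (1 + 4 * (Lc : ℝ)) ^ (3 + 1))) :=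
        mul_le_mul_of_nonneg_left h (by positivity)
    _ = bPhi Lc q := by unfold bPhi; field_simp

/-- [folklore] `‖N⁻³·srcC(f̂_{l,y′})‖ ≤ bC Lc q`. -/
theorem srcC_bound (hNM : N = M * Lc) (hq : ∀ i, |q i| ≤ π) (hq0 : q ≠ 0) (l : Fin (3 + 1)) (y' : Fin (3 + 1) → ℤ) :
    ‖(((N : ℂ) ^ 3)⁻¹) * srcC N (ofRealVec q) (fhatF N M (ofRealVec q) l y')‖ ≤ bC Lc q := by
  have hN0 : (0 : ℝ) < N := by exact_mod_cast Nat.pos_of_ne_zero (NeZero.ne N)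
  have h := norm_srcC_fhatF_le hNM hq hq0 l y'
  rw [norm_mul, norm_inv, norm_pow, Complex.norm_natCast]
  calc ((N : ℝ) ^ 3)⁻¹ * ‖srcC N (ofRealVec q) (fhatF N M (ofRealVec q) l y')‖
      ≤ ((N : ℝ) ^ 3)⁻¹ * ((N : ℝ) ^ 3 * (π ^ 4 / 16 / (momSq q * Real.sqrt (momSq q)) + (Lc : ℝ) / 8 * (1 + 4 * (Lc : ℝ)) ^ (3 + 1))) :=
        mul_le_mul_of_nonneg_left h (by positivity)
    _ = bC Lc q := by unfold bC; field_simp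

/-- [folklore] `‖N′⁻³·srcPhi′ − N⁻³·srcPhi‖ ≤ rPhi Lc/N²` (leaf-07's `srcPhi_rate`, `x/N³ = N⁻³·x`). -/
theorem srcPhi_rate' (hNM : N = M * Lc) (hN'M' : N' = M' * Lc) (hNN' : N ≤ N') (hq : ∀ i, |q i| ≤ π) (hq0 : q ≠ 0)
    (l : Fin (3 + 1)) (y' : Fin (3 + 1) → ℤ) (l' : Fin (3 + 1)) :
    ‖(((N' : ℂ) ^ 3)⁻¹) * srcPhi N' (ofRealVec q) (fhatF N' M' (ofRealVec q) l y') 0 l'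
        - (((N : ℂ) ^ 3)⁻¹) * srcPhi N (ofRealVec q) (fhatF N M (ofRealVec q) l y') 0 l'‖ ≤ rPhi Lc / (N : ℝ) ^ 2 := by
  rw [← div_eq_inv_mul, ← div_eq_inv_mul]
  unfold rPhi
  exact srcPhi_rate hNM hN'M' hNN' hq hq0 l' l y'

/-- [folklore] `‖N′⁻³·srcC′ − N⁻³·srcC‖ ≤ rC Lc q/N²` (leaf-07's `srcC_rate`). -/
theorem srcC_rate' (hNM : N = M * Lc) (hN'M' : N' = M' * Lc) (hNN' : N ≤ N') (hq : ∀ i, |q i| ≤ π) (hq0 : q ≠ 0)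
    (l : Fin (3 + 1)) (y' : Fin (3 + 1) → ℤ) :
    ‖(((N' : ℂ) ^ 3)⁻¹) * srcC N' (ofRealVec q) (fhatF N' M' (ofRealVec q) l y')
        - (((N : ℂ) ^ 3)⁻¹) * srcC N (ofRealVec q) (fhatF N M (ofRealVec q) l y')‖ ≤ rC Lc q / (N : ℝ) ^ 2 := by
  rw [← div_eq_inv_mul, ← div_eq_inv_mul]
  unfold rC
  exact srcC_rate hNM hN'M' hNN' hq hq0 l y'

/-- [folklore] **`R_φ = −conj S_φ`** summed over ALL classes (leaf-07's `readingPhi_eq`; at real `q ≠ 0` every class is regular). -/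
theorem sum_rPhiTerm_eq (M : ℕ) (hq : ∀ i, |q i| ≤ π) (hq0 : q ≠ 0) (κ l' : Fin (3 + 1)) (x' : Fin (3 + 1) → ℤ) :
    ∑ m, rPhiTerm N M (ofRealVec q) m κ l' x' = -conj (srcPhi N (ofRealVec q) (fhatF N M (ofRealVec q) κ x') 0 l') := by
  have hN : 1 ≤ N := Nat.one_le_iff_ne_zero.2 (NeZero.ne N)
  rw [← readingPhi_eq (conj_ofRealVec q) κ l' x', reg_eq_univ N (ofRealVec q) (LAl_ofRealVec_ne_zero hN hq hq0)]
  exact Finset.sum_congr rfl fun m _ => by unfold FibreRateFeedTerms.rPhiTerm; ring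

/-- [folklore] **`R_c = −conj S_c`** summed over all classes (leaf-07's `readingC_eq`). -/
theorem sum_rCTerm_eq (M : ℕ) (hq : ∀ i, |q i| ≤ π) (hq0 : q ≠ 0) (κ : Fin (3 + 1)) (x' : Fin (3 + 1) → ℤ) :
    ∑ m, rCTerm N M (ofRealVec q) m κ x' = -conj (srcC N (ofRealVec q) (fhatF N M (ofRealVec q) κ x')) := by
  have hN : 1 ≤ N := Nat.one_le_iff_ne_zero.2 (NeZero.ne N)
  rw [← readingC_eq (conj_ofRealVec q) κ x', reg_eq_univ N (ofRealVec q) (LAl_ofRealVec_ne_zero hN hq hq0)]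
  exact Finset.sum_congr rfl fun m _ => by unfold FibreRateFeedTerms.rCTerm; ring

omit [NeZero N] in
/-- [folklore] The natural-number inverse cube is real: `conj (N⁻³·z) = N⁻³·conj z`. -/
theorem conj_invCube_mul (z : ℂ) : conj ((((N : ℂ) ^ 3)⁻¹) * z) = (((N : ℂ) ^ 3)⁻¹) * conj z := by
  rw [map_mul, map_inv₀, map_pow, Complex.conj_natCast]

/-- [folklore] Reading-side bound: `‖N⁻³·Σ_m R_φ(κ, l′; x′)‖ ≤ bPhi Lc q`. -/
theorem rPhi_bound (hNM : N = M * Lc) (hq : ∀ i, |q i| ≤ π) (hq0 : q ≠ 0) (κ : Fin (3 + 1)) (x' : Fin (3 + 1) → ℤ) (l' : Fin (3 + 1)) :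
    ‖(((N : ℂ) ^ 3)⁻¹) * ∑ m, rPhiTerm N M (ofRealVec q) m κ l' x'‖ ≤ bPhi Lc q := by
  rw [sum_rPhiTerm_eq M hq hq0, mul_neg, norm_neg, norm_mul, Complex.norm_conj, ← norm_mul]
  exact srcPhi_bound hNM hq hq0 κ x' l'

/-- [folklore] Reading-side bound: `‖N⁻³·Σ_m R_c(κ; x′)‖ ≤ bC Lc q`. -/
theorem rC_bound (hNM : N = M * Lc) (hq : ∀ i, |q i| ≤ π) (hq0 : q ≠ 0) (κ : Fin (3 + 1)) (x' : Fin (3 + 1) → ℤ) :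
    ‖(((N : ℂ) ^ 3)⁻¹) * ∑ m, rCTerm N M (ofRealVec q) m κ x'‖ ≤ bC Lc q := by
  rw [sum_rCTerm_eq M hq hq0, mul_neg, norm_neg, norm_mul, Complex.norm_conj, ← norm_mul]
  exact srcC_bound hNM hq hq0 κ x'

/-- [folklore] Reading-side rate: `‖N′⁻³Σ′R_φ − N⁻³ΣR_φ‖ ≤ rPhi Lc/N²`. -/
theorem rPhi_rate (hNM : N = M * Lc) (hN'M' : N' = M' * Lc) (hNN' : N ≤ N') (hq : ∀ i, |q i| ≤ π) (hq0 : q ≠ 0)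
    (κ : Fin (3 + 1)) (x' : Fin (3 + 1) → ℤ) (l' : Fin (3 + 1)) :
    ‖(((N' : ℂ) ^ 3)⁻¹) * ∑ m, rPhiTerm N' M' (ofRealVec q) m κ l' x' - (((N : ℂ) ^ 3)⁻¹) * ∑ m, rPhiTerm N M (ofRealVec q) m κ l' x'‖
      ≤ rPhi Lc / (N : ℝ) ^ 2 := by
  rw [sum_rPhiTerm_eq M' hq hq0, sum_rPhiTerm_eq M hq hq0, mul_neg, mul_neg, ← conj_invCube_mul, ← conj_invCube_mul, ← neg_sub_neg, neg_neg,
    neg_neg, ← map_sub, Complex.norm_conj, norm_sub_rev]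
  exact srcPhi_rate' hNM hN'M' hNN' hq hq0 κ x' l'

/-- [folklore] Reading-side rate: `‖N′⁻³Σ′R_c − N⁻³ΣR_c‖ ≤ rC Lc q/N²`. -/
theorem rC_rate (hNM : N = M * Lc) (hN'M' : N' = M' * Lc) (hNN' : N ≤ N') (hq : ∀ i, |q i| ≤ π) (hq0 : q ≠ 0)
    (κ : Fin (3 + 1)) (x' : Fin (3 + 1) → ℤ) :
    ‖(((N' : ℂ) ^ 3)⁻¹) * ∑ m, rCTerm N' M' (ofRealVec q) m κ x' - (((N : ℂ) ^ 3)⁻¹) * ∑ m, rCTerm N M (ofRealVec q) m κ x'‖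
      ≤ rC Lc q / (N : ℝ) ^ 2 := by
  rw [sum_rCTerm_eq M' hq hq0, sum_rCTerm_eq M hq hq0, mul_neg, mul_neg, ← conj_invCube_mul, ← conj_invCube_mul, ← neg_sub_neg, neg_neg,
    neg_neg, ← map_sub, Complex.norm_conj, norm_sub_rev]
  exact srcC_rate' hNM hN'M' hNN' hq hq0 κ x'

end Data

end Summit.QuantumFields.BalabanUV.Beta.GAN24.FibreRateData

end
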